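import Summits.AtomisticToContinuum.HydrodynamicLimit.Theorems.CollisionIsometryCLTDiffuseBackwardInfluenceDefs
import Summits.AtomisticToContinuum.HydrodynamicLimit.Theorems.JParityClosureOddContactSymmetryGibbsInvariance
import Summits.AtomisticToContinuum.HydrodynamicLimit.Theorems.InfluenceLocality.Negative.Certification
import Literature.Analysis.FluidPDE.HardSphereWindowCount
import HarnessLib

/-!
# `stub_fewIdleSuperExp` reduced to ONE named static estimate, the tube large deviation
(crux `DiffuseBackwardInfluence`, stmt-AtomisticToContinuum-12950, line `share-nondegeneracy-one-flight`; support
file of the registered sub-goal `fewIdleSuperExp_of_tubeLD`)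

The registered stub `stub_fewIdleSuperExp` (per-slot idleness — a fraction `≥ δ` of the `N+1` spheres suffers NO
collision during slot `r` of an admissible window, a slot lasting `Δ_N/S ≫ (N+1)^{-1/3} ≍` mean free time — is
super-exponentially rare under the invariant hard-sphere Gibbs law `eqLaw σ θ = localGibbsLaw σ 1 0 θ`) is an
honest large-deviation estimate with no proof in the tree or in print. This file
1. AUDITS the formal statement: `δ > 1` ⇒ empty event (`FewIdle.setOf_le_idleFr_eq_empty`); the EMPTY-SLOT corner
   — a slot with no fold step makes every particle idle, `idleFr = 1` (`FewIdle.idleFr_eq_one_of_slot_empty`), and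
   is priced by the reduction like any idle pattern; the junk value `colls = 0` (Zeno orbits, overlapping data) lives
   on the complement of the Alexander good set, which is `eqLaw`-NULL (`FewIdle.eqLaw_compl_good`: `eqLaw ≪ liouville`
   and `Alexander.torusFlow_ae_good_holds`); `colls σ N y t` counts the CLOSED window `[0, t]`, so slot `r` = fold
   steps with index in `[colls (rΔ/S), colls ((r+1)Δ/S))` = collisions with instant in `(rΔ/S, (r+1)Δ/S]`
   (`Alexander.collisionCount_spec`); `eqLaw` does not depend on `Φ` (`FewIdle.eqLaw_irrel`, `rfl`). Verdict:
   faithful, not vacuous, not cheaply false;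
2. ISOLATES the missing estimate as ONE named proposition `FewIdle.TubeLD σ θ` (`@[conjecture]`; verbatim the body
   of `stub_tubeNonCrossingLD` of the sibling line skeleton `Cruxes/DiffuseBackwardInfluence/Lines/ballistic-tubes.lean`
   at the given `σ`, temperature `θ` instead of `1`);
3. PROVES `fewIdleSuperExp_of_tubeLD : … → FewIdle.TubeLD σ θ → ∀ Φ, FewIdleSuperExpAt σ θ Φ` (`0 < σ < 1/2`) from
   tree facts only: the Alexander flow as a `Flow σ N` (the tree's `InfluenceLocality.Negative.alexanderFlow`);
   INVARIANCE of `eqLaw` under it (`map_flow_localGibbsLaw_const`) and transport of an arbitrary event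
   (`Measure.le_map_apply`); KINEMATICS — a collision step not touching particle `i` moves it by free flight
   (`collidePair_apply_of_ne`), so an idle particle flies straight across its slot (`FewIdle.fwdFlow_apply_of_untouched`)
   and two idle particles keep distance `≥ ε_N` along their straight tubes (`FwdGood.fwdFlow_mem`); the pathwise
   inclusion `{δ ≤ idleFr} ⊆ goodᶜ ∪ ⋃_{|A| ≥ δ(N+1)} (T^{rΔ/S})⁻¹ (tubeSet A (Δ/S))` (`FewIdle.setOf_le_idleFr_subset`,
   `A` = the idle set itself), the union bound over `≤ 2^{N+1}` index sets and `2^{N+1} e^{-(h+1)(N+1)} ≤ e^{-h(N+1)}`.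
Not attempted: billiard hyperbolicity / a cluster expansion proving `TubeLD` (heuristic price `≍ 3η(N+1) log n_τ` nats
of velocity coherence, `n_τ = σ²√θ τ_N (N+1)^{1/3} → ∞`; lanes / sheets / expanding patterns still pay `≥ η(N+1) log n_τ`).
-/

namespace Summit.AtomisticToContinuum.HydrodynamicLimit.Theorems.DiffuseBackwardInfluenceShare

open scoped BigOperators Topology ENNReal Classical
open Filter Set MeasureTheory
open Literature.Analysis.FluidPDE
open Literature.MathematicalPhysics.KineticTheory (localGibbsLaw hsDiameter hsDiameter_pos hsDiameter_le)
open Summit.AtomisticToContinuum.HydrodynamicLimit.Theorems.InfluenceLocality.Negative (alexanderFlow)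
open Summit.AtomisticToContinuum.HydrodynamicLimit.Theorems.DiffuseBackwardInfluenceNeg

noncomputable section

namespace FewIdle

/-- **THE STATIC TUBE LARGE DEVIATION** at reduced density `σ` and temperature `θ` — an OPEN named conjecture of
this programme (obligation node; body = `stub_tubeNonCrossingLD` of `Cruxes/DiffuseBackwardInfluence/Lines/ballistic-tubes.lean`
at the given `σ`, temperature `θ` instead of `1`): for tube lengths `τ_N > 0` with `τ_N (N+1)^{1/3} → ∞`, every
`η > 0` and every rate `c`, eventually in `N`, for every flow `Φ` (dummy: `eqLaw_irrel`) and EVERY index set `A`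
with `|A| ≥ η(N+1)`, the `eqLaw σ θ`-probability that the straight tubes `r ↦ xᵢ + r vᵢ`, `r ∈ [0, τ_N]`, of the
particles of `A` stay pairwise at minimal-image distance `≥ ε_N` is `≤ exp (-c (N+1))`. (The union over index sets
is taken in `fewIdleSuperExp_of_tubeLD`; the event is antitone in `τ_N`.) No proof in the tree or in print;
heuristic cost `≍ 3η(N+1) log(σ²√θ τ_N (N+1)^{1/3})` nats of velocity coherence. -/
@[conjecture] def TubeLD (σ θ : ℝ) : Prop :=
  ∀ τ : ℕ → ℝ, (∀ N, 0 < τ N) → Tendsto (fun N : ℕ => τ N * ((N + 1 : ℕ) : ℝ) ^ ((1 : ℝ) / 3)) atTop atTop →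
    ∀ η : ℝ, 0 < η → ∀ c : ℝ, ∀ᶠ N : ℕ in atTop, ∀ (Φ : Flow σ N) (A : Finset (Fin (N + 1))),
      η * ((N + 1 : ℕ) : ℝ) ≤ (A.card : ℝ) →
        eqLaw σ θ N Φ {z : Cfg N | ∀ i ∈ A, ∀ j ∈ A, i ≠ j → ∀ r ∈ Set.Icc (0 : ℝ) (τ N),
          hsDiameter σ N ≤ ‖(Torus.geometry (Fin 3)).sepVec (freeFlight (Torus.geometry (Fin 3)) r z i).1
            (freeFlight (Torus.geometry (Fin 3)) r z j).1‖} ≤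
          ENNReal.ofReal (Real.exp (-(c * ((N + 1 : ℕ) : ℝ))))

/-! ## The Alexander flow as a `Flow σ N`, and the invariant law along it -/

/-- `ε_N < 1/2` for `σ < 1/2` (with `0 < ε_N`, `hsDiameter_pos`: the range of Alexander's theorem on `𝕋³`, so the
tree's collision-by-collision flow `alexanderFlow (hsDiameter_pos hσ N) (hsDiameter_lt_half hσ.le hσ2 N) (N + 1)`
is a `Flow σ N` with flow map `Alexander.flow` and good set `Alexander.good`). [folklore] -/
theorem hsDiameter_lt_half {σ : ℝ} (hσ : 0 ≤ σ) (hσ2 : σ < 1 / 2) (N : ℕ) : hsDiameter σ N < 2⁻¹ :=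
  (hsDiameter_le hσ N).trans_lt (by rw [inv_eq_one_div]; exact hσ2)

/-- `eqLaw` does not depend on the flow argument. [folklore] -/
theorem eqLaw_irrel (σ θ : ℝ) (N : ℕ) (Φ Φ' : Flow σ N) : eqLaw σ θ N Φ = eqLaw σ θ N Φ' := rfl

/-- Transport of an ARBITRARY event along the Alexander flow does not increase its `eqLaw`-measure
(invariance `map_flow_localGibbsLaw_const` + `Measure.le_map_apply`; no measurability needed). [folklore] -/
theorem eqLaw_preimage_flow_le {σ : ℝ} (hσ : 0 < σ) (hσ2 : σ < 1 / 2) (θ : ℝ) (N : ℕ) (Φ : Flow σ N)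
    (t : ℝ) (E : Set (Cfg N)) :
    eqLaw σ θ N Φ (Alexander.flow (Torus.geometry (Fin 3)) (hsDiameter σ N) t ⁻¹' E) ≤ eqLaw σ θ N Φ E := by
  let Ψ : Flow σ N := alexanderFlow (hsDiameter_pos hσ N) (hsDiameter_lt_half hσ.le hσ2 N) (N + 1)
  rw [eqLaw_irrel σ θ N Φ Ψ]
  have hmap : (eqLaw σ θ N Ψ).map (Ψ.flow t) = eqLaw σ θ N Ψ := map_flow_localGibbsLaw_const σ 1 θ 0 N Ψ t
  exact (Measure.le_map_apply (Ψ.measurable_flow t).aemeasurable E).trans_eq (by rw [hmap])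

/-- The complement of the Alexander good set is `eqLaw`-null (`eqLaw ≪ liouville` and Alexander's theorem). [folklore] -/
theorem eqLaw_compl_good {σ : ℝ} (hσ : 0 < σ) (hσ2 : σ < 1 / 2) (θ : ℝ) (N : ℕ) (Φ : Flow σ N) :
    eqLaw σ θ N Φ (Alexander.good (Torus.geometry (Fin 3)) (hsDiameter σ N))ᶜ = 0 := by
  have hac : eqLaw σ θ N Φ ≪ liouville (Torus.geometry (Fin 3)) (N + 1) (hsDiameter σ N) := by
    unfold eqLaw localGibbsLaw
    rw [particleLaw_eq]
    exact withDensity_absolutelyContinuous _ _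
  exact hac (Alexander.torusFlow_ae_good_holds (hsDiameter_pos hσ N) (hsDiameter_lt_half hσ.le hσ2 N) (N + 1))


/-! ## Kinematics of the Alexander construction: untouched particles fly freely -/

section Kinematics

variable {d : Type*} [Fintype d] {X : Type*} {n : ℕ} {G : Geometry d X} {ε : ℝ}

/-- Per-particle composition of free flights: if particle `i` of `w` is particle `i` of `z` flown for time `t`,
then flying `w` for time `s` puts `i` where flying `z` for time `t + s` does. [folklore] -/
theorem freeFlight_apply_of_apply_eq {z w : Config n d X} {i : Fin n} {t : ℝ}
    (hw : w i = freeFlight G t z i) (s : ℝ) : freeFlight G s w i = freeFlight G (t + s) z i := by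
  simp only [freeFlight_apply] at hw ⊢
  rw [hw]
  simp only [Geometry.translate_add, add_smul]

/-- **One collision step does not touch a particle outside the reflected pair**: if the `k`-th free flight is
finite and particle `i` is not an endpoint of the pair `h.some` the step reflects, then in `z_{k+1}` particle `i`
is particle `i` of `z_k` flown freely for the exit time `τ(z_k)`. [folklore] -/
theorem stateAfter_succ_apply_of_forall_ne {y : Config n d X} {k : ℕ} {i : Fin n}
    (hfin : Alexander.freeExitTime G ε (Alexander.stateAfter G ε y k) ≠ ∞)
    (hi : ∀ h : (Alexander.incomingPairs G ε (freeFlight G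
        (Alexander.freeExitTime G ε (Alexander.stateAfter G ε y k)).toReal
        (Alexander.stateAfter G ε y k))).Nonempty, h.some.1 ≠ i ∧ h.some.2 ≠ i) :
    Alexander.stateAfter G ε y (k + 1) i =
      freeFlight G (Alexander.freeExitTime G ε (Alexander.stateAfter G ε y k)).toReal
        (Alexander.stateAfter G ε y k) i := by
  rw [Alexander.stateAfter_succ]
  unfold Alexander.collisionStep
  rw [if_neg hfin]
  split_ifs with h
  · exact collidePair_apply_of_ne (G := G) (hi h).1.symm (hi h).2.symm _
  · rfl

/-- **Untouched particles fly freely, state by state**: if `t_k < ∞` and no step `m ∈ [c₀, k)` touches particle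
`i`, then in `z_k` particle `i` is particle `i` of `z_{c₀}` flown freely for `t_k - t_{c₀}`. [folklore] -/
theorem stateAfter_apply_of_untouched {y : Config n d X} {i : Fin n} {c₀ : ℕ} :
    ∀ k, c₀ ≤ k → Alexander.collisionInstant G ε y k ≠ ∞ →
      (∀ m, c₀ ≤ m → m < k → ∀ h : (Alexander.incomingPairs G ε (freeFlight G
          (Alexander.freeExitTime G ε (Alexander.stateAfter G ε y m)).toReal
          (Alexander.stateAfter G ε y m))).Nonempty, h.some.1 ≠ i ∧ h.some.2 ≠ i) →
      Alexander.stateAfter G ε y k i =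
        freeFlight G ((Alexander.collisionInstant G ε y k).toReal -
            (Alexander.collisionInstant G ε y c₀).toReal) (Alexander.stateAfter G ε y c₀) i := by
  intro k hk
  induction k, hk using Nat.le_induction with
  | base =>
    intro _ _
    rw [sub_self, freeFlight_zero]
  | succ k hk ih =>
    intro hfin hidle
    have hfin' : Alexander.collisionInstant G ε y k ≠ ∞ ∧
        Alexander.freeExitTime G ε (Alexander.stateAfter G ε y k) ≠ ∞ := by
      rwa [Alexander.collisionInstant_succ, ENNReal.add_ne_top] at hfin
    have hstep := stateAfter_succ_apply_of_forall_ne hfin'.2 (hidle k hk (Nat.lt_succ_self k))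
    have hprev := ih hfin'.1 (fun m hm hmk => hidle m hm (hmk.trans (Nat.lt_succ_self k)))
    have htime : (Alexander.collisionInstant G ε y k).toReal - (Alexander.collisionInstant G ε y c₀).toReal +
        (Alexander.freeExitTime G ε (Alexander.stateAfter G ε y k)).toReal =
        (Alexander.collisionInstant G ε y (k + 1)).toReal - (Alexander.collisionInstant G ε y c₀).toReal := by
      rw [Alexander.collisionInstant_succ, ENNReal.toReal_add hfin'.1 hfin'.2]
      ring
    rw [hstep, freeFlight_apply_of_apply_eq hprev, htime]

/-- The collision count of a forward-good orbit is monotone in time. [folklore] -/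
theorem collisionCount_mono {y : Config n d X} (hgood : Alexander.FwdGood G ε y) {u v : ℝ} (huv : u ≤ v) :
    Alexander.collisionCount G ε y u ≤ Alexander.collisionCount G ε y v :=
  (Alexander.le_collisionCount_iff hgood).2
    ((Alexander.collisionCount_spec hgood u).1.trans (ENNReal.ofReal_le_ofReal huv))

/-- **Untouched particles fly freely along the forward flow**: on a forward-good orbit, if no collision step
with index in `[#coll[0,a], #coll[0,a+s])` — i.e. with instant in `(a, a+s]` — touches particle `i`, then
`(Φ_{a+s} y)_i = (S_s Φ_a y)_i`. [folklore] -/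
theorem fwdFlow_apply_of_untouched {y : Config n d X} (hgood : Alexander.FwdGood G ε y) {i : Fin n} {a s : ℝ}
    (hs : 0 ≤ s)
    (hidle : ∀ m, Alexander.collisionCount G ε y a ≤ m → m < Alexander.collisionCount G ε y (a + s) →
        ∀ h : (Alexander.incomingPairs G ε (freeFlight G
          (Alexander.freeExitTime G ε (Alexander.stateAfter G ε y m)).toReal
          (Alexander.stateAfter G ε y m))).Nonempty, h.some.1 ≠ i ∧ h.some.2 ≠ i) :
    Alexander.fwdFlow G ε y (a + s) i = freeFlight G s (Alexander.fwdFlow G ε y a) i := by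
  obtain ⟨ha1, -⟩ := Alexander.collisionCount_spec hgood a
  obtain ⟨hb1, -⟩ := Alexander.collisionCount_spec hgood (a + s)
  have hfin₁ : Alexander.collisionInstant G ε y (Alexander.collisionCount G ε y (a + s)) ≠ ∞ :=
    ne_top_of_le_ne_top ENNReal.ofReal_ne_top hb1
  have hle : Alexander.collisionCount G ε y a ≤ Alexander.collisionCount G ε y (a + s) :=
    collisionCount_mono hgood (le_add_of_nonneg_right hs)
  have hstate := stateAfter_apply_of_untouched (G := G) (ε := ε) (y := y) (i := i)
    (Alexander.collisionCount G ε y (a + s)) hle hfin₁ hidle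
  have h1 : Alexander.fwdFlow G ε y (a + s) i =
      freeFlight G (a + s - (Alexander.collisionInstant G ε y (Alexander.collisionCount G ε y (a + s))).toReal)
        (Alexander.stateAfter G ε y (Alexander.collisionCount G ε y (a + s))) i := rfl
  have h2 : Alexander.fwdFlow G ε y a i =
      freeFlight G (a - (Alexander.collisionInstant G ε y (Alexander.collisionCount G ε y a)).toReal)
        (Alexander.stateAfter G ε y (Alexander.collisionCount G ε y a)) i := rfl
  have htime : (Alexander.collisionInstant G ε y (Alexander.collisionCount G ε y (a + s))).toReal -
        (Alexander.collisionInstant G ε y (Alexander.collisionCount G ε y a)).toReal +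
      (a + s - (Alexander.collisionInstant G ε y (Alexander.collisionCount G ε y (a + s))).toReal) =
      a - (Alexander.collisionInstant G ε y (Alexander.collisionCount G ε y a)).toReal + s := by
    ring
  rw [h1, freeFlight_apply_of_apply_eq hstate, freeFlight_apply_of_apply_eq h2, htime]

/-- **Two untouched particles keep their hard-core distance along their straight tubes**: on a forward-good
orbit (`a ≥ 0`), if no step with instant in `(a, a+s]` touches `i` or `j ≠ i`, then the free flights of
`(Φ_a y)_i` and `(Φ_a y)_j` are at minimal-image distance `≥ ε` at time `s` (they ARE the positions of
`Φ_{a+s} y`, which lies in the hard-sphere domain). [folklore] -/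
theorem le_norm_sepVec_freeFlight_of_untouched {y : Config n d X} (hgood : Alexander.FwdGood G ε y)
    {i j : Fin n} (hij : i ≠ j) {a s : ℝ} (ha : 0 ≤ a) (hs : 0 ≤ s)
    (hi : ∀ m, Alexander.collisionCount G ε y a ≤ m → m < Alexander.collisionCount G ε y (a + s) →
        ∀ h : (Alexander.incomingPairs G ε (freeFlight G
          (Alexander.freeExitTime G ε (Alexander.stateAfter G ε y m)).toReal
          (Alexander.stateAfter G ε y m))).Nonempty, h.some.1 ≠ i ∧ h.some.2 ≠ i)
    (hj : ∀ m, Alexander.collisionCount G ε y a ≤ m → m < Alexander.collisionCount G ε y (a + s) →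
        ∀ h : (Alexander.incomingPairs G ε (freeFlight G
          (Alexander.freeExitTime G ε (Alexander.stateAfter G ε y m)).toReal
          (Alexander.stateAfter G ε y m))).Nonempty, h.some.1 ≠ j ∧ h.some.2 ≠ j) :
    ε ≤ ‖G.sepVec (freeFlight G s (Alexander.fwdFlow G ε y a) i).1
      (freeFlight G s (Alexander.fwdFlow G ε y a) j).1‖ := by
  rw [← fwdFlow_apply_of_untouched hgood hs hi, ← fwdFlow_apply_of_untouched hgood hs hj]
  exact hgood.fwdFlow_mem (add_nonneg ha hs) i j hij

end Kinematics

/-! ## The slot vocabulary of the line, and the static tube event -/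

/-- A fold step that does not touch `i` reflects a pair avoiding `i` (unfolding of `Touches`). [folklore] -/
theorem forall_ne_of_not_touches {σ : ℝ} {N : ℕ} {y : Cfg N} {k : ℕ} {i : Fin (N + 1)}
    (h : ¬ Touches σ N y k i) :
    ∀ h' : (Alexander.incomingPairs (Torus.geometry (Fin 3)) (hsDiameter σ N)
        (freeFlight (Torus.geometry (Fin 3))
          (Alexander.freeExitTime (Torus.geometry (Fin 3)) (hsDiameter σ N)
            (Alexander.stateAfter (Torus.geometry (Fin 3)) (hsDiameter σ N) y k)).toReal
          (Alexander.stateAfter (Torus.geometry (Fin 3)) (hsDiameter σ N) y k))).Nonempty,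
      h'.some.1 ≠ i ∧ h'.some.2 ≠ i := by
  intro h'
  simp only [Touches, not_exists, not_or] at h
  exact h h'

/-- The STATIC TUBE EVENT of an index set `A` over `[0, τ]`: the straight tubes `r ↦ xᵢ + r vᵢ`, `r ∈ [0, τ]`,
of the particles of `A` stay pairwise at minimal-image distance `≥ ε_N` (the event of `TubeLD`). -/
def tubeSet (σ : ℝ) (N : ℕ) (A : Finset (Fin (N + 1))) (τ : ℝ) : Set (Cfg N) :=
  {z | ∀ i ∈ A, ∀ j ∈ A, i ≠ j → ∀ r ∈ Set.Icc (0 : ℝ) τ,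
    hsDiameter σ N ≤ ‖(Torus.geometry (Fin 3)).sepVec (freeFlight (Torus.geometry (Fin 3)) r z i).1
      (freeFlight (Torus.geometry (Fin 3)) r z j).1‖}

/-- **The reduction, pathwise.** A configuration with idle fraction `≥ δ` on slot `r` is either outside the
Alexander good set, or is carried by the Alexander flow at the slot start `rΔ/S` into the static tube event
(over the slot length `Δ/S`) of some index set of `≥ δ(N+1)` particles — namely its own idle set. [folklore] -/
theorem setOf_le_idleFr_subset (σ : ℝ) (N : ℕ) {Δ : ℝ} (hΔ : 0 ≤ Δ) (S r : ℕ) (δ : ℝ) :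
    {y : Cfg N | δ ≤ idleFr σ N y Δ S r} ⊆
      (Alexander.good (Torus.geometry (Fin 3)) (hsDiameter σ N))ᶜ ∪
        ⋃ A ∈ (Finset.univ.filter fun A : Finset (Fin (N + 1)) => δ * ((N + 1 : ℕ) : ℝ) ≤ (A.card : ℝ)),
          Alexander.flow (Torus.geometry (Fin 3)) (hsDiameter σ N) ((r : ℝ) * Δ / (S : ℝ)) ⁻¹'
            tubeSet σ N A (Δ / (S : ℝ)) := by
  intro y hy
  by_cases hg : y ∈ Alexander.good (Torus.geometry (Fin 3)) (hsDiameter σ N)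
  swap
  · exact Or.inl hg
  right
  simp only [mem_iUnion, Finset.mem_filter, Finset.mem_univ, true_and, exists_prop]
  refine ⟨Finset.univ.filter fun i : Fin (N + 1) => IdleOn σ N y Δ S r i, ?_, ?_⟩
  · have hN : (0 : ℝ) < ((N + 1 : ℕ) : ℝ) := by positivity
    have hy' : δ ≤ idleFr σ N y Δ S r := hy
    unfold idleFr at hy'
    rwa [le_div_iff₀ hN] at hy'
  · simp only [mem_preimage, tubeSet, mem_setOf_eq]
    intro i hi j hj hij s hs
    have ha : 0 ≤ (r : ℝ) * Δ / (S : ℝ) := by positivity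
    rw [Alexander.flow_of_nonneg ha]
    have hgood : Alexander.FwdGood (Torus.geometry (Fin 3)) (hsDiameter σ N) y := hg.2.2.1
    have hcount : Alexander.collisionCount (Torus.geometry (Fin 3)) (hsDiameter σ N) y ((r : ℝ) * Δ / (S : ℝ) + s) ≤
        slotStart σ N y Δ S (r + 1) := by
      show _ ≤ Alexander.collisionCount (Torus.geometry (Fin 3)) (hsDiameter σ N) y (((r + 1 : ℕ) : ℝ) * Δ / (S : ℝ))
      exact collisionCount_mono hgood (by push_cast; rw [add_mul, one_mul, add_div]; linarith [hs.2])
    have hI : IdleOn σ N y Δ S r i := (Finset.mem_filter.1 hi).2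
    have hJ : IdleOn σ N y Δ S r j := (Finset.mem_filter.1 hj).2
    exact le_norm_sepVec_freeFlight_of_untouched hgood hij ha hs.1
      (fun m hm1 hm2 => forall_ne_of_not_touches (hI m hm1 (lt_of_lt_of_le hm2 hcount)))
      (fun m hm1 hm2 => forall_ne_of_not_touches (hJ m hm1 (lt_of_lt_of_le hm2 hcount)))

/-- **The reduction, in measure.** Under the invariant law the idle event of slot `r` is bounded by the sum,
over index sets `A` of `≥ δ(N+1)` particles, of the probabilities of the STATIC tube events of `A` over the slot
length (good set conull, union bound, invariance of `eqLaw` under the Alexander flow). [folklore] -/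
theorem eqLaw_setOf_le_idleFr_le {σ : ℝ} (hσ : 0 < σ) (hσ2 : σ < 1 / 2) (θ : ℝ) (N : ℕ) (Φ : Flow σ N)
    {Δ : ℝ} (hΔ : 0 ≤ Δ) (S r : ℕ) (δ : ℝ) :
    eqLaw σ θ N Φ {y : Cfg N | δ ≤ idleFr σ N y Δ S r} ≤
      ∑ A ∈ (Finset.univ.filter fun A : Finset (Fin (N + 1)) => δ * ((N + 1 : ℕ) : ℝ) ≤ (A.card : ℝ)),
        eqLaw σ θ N Φ (tubeSet σ N A (Δ / (S : ℝ))) := by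
  refine (measure_mono (setOf_le_idleFr_subset σ N hΔ S r δ)).trans ((measure_union_le _ _).trans ?_)
  rw [eqLaw_compl_good hσ hσ2, zero_add]
  exact (measure_biUnion_finset_le _ _).trans
    (Finset.sum_le_sum fun A _ => eqLaw_preimage_flow_le hσ hσ2 θ N Φ _ _)

/-- The union over index sets is free in the super-exponential currency:
`2^{N+1} e^{-(h+1)(N+1)} ≤ e^{-h(N+1)}`. [folklore] -/
theorem two_pow_mul_exp_le (h : ℝ) (N : ℕ) :
    (2 : ℝ) ^ (N + 1) * Real.exp (-((h + 1) * ((N + 1 : ℕ) : ℝ))) ≤ Real.exp (-(h * ((N : ℝ) + 1))) := by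
  have h2 : (2 : ℝ) ^ (N + 1) ≤ Real.exp ((N + 1 : ℕ) : ℝ) := by
    have h21 : (2 : ℝ) ≤ Real.exp 1 := by linarith [Real.add_one_le_exp (1 : ℝ)]
    calc (2 : ℝ) ^ (N + 1) ≤ (Real.exp 1) ^ (N + 1) := pow_le_pow_left₀ (by norm_num) h21 _
      _ = Real.exp ((N + 1 : ℕ) : ℝ) := by rw [← Real.exp_one_pow]
  calc (2 : ℝ) ^ (N + 1) * Real.exp (-((h + 1) * ((N + 1 : ℕ) : ℝ)))
      ≤ Real.exp ((N + 1 : ℕ) : ℝ) * Real.exp (-((h + 1) * ((N + 1 : ℕ) : ℝ))) :=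
        mul_le_mul_of_nonneg_right h2 (Real.exp_pos _).le
    _ = Real.exp (-(h * ((N : ℝ) + 1))) := by
        rw [← Real.exp_add]; congr 1; push_cast; ring

/-- **`TubeLD ⇒ FewIdleSuperExpAt`** (hypothesis form). [folklore] -/
theorem fewIdleSuperExpAt_of_tubeLD {σ θ : ℝ} (hσ : 0 < σ) (hσ2 : σ < 1 / 2) (hT : TubeLD σ θ)
    (Φ : (N : ℕ) → Flow σ N) : FewIdleSuperExpAt σ θ Φ := by
  intro Δ hΔ _hΔ0 hΔg S r hS _hr δ h hδ _hh
  have hSpos : (0 : ℝ) < (S : ℝ) := by exact_mod_cast hS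
  have hτ : ∀ N, 0 < Δ N / (S : ℝ) := fun N => div_pos (hΔ N) hSpos
  have hτg : Tendsto (fun N : ℕ => Δ N / (S : ℝ) * ((N + 1 : ℕ) : ℝ) ^ ((1 : ℝ) / 3)) atTop atTop := by
    have heq : (fun N : ℕ => Δ N / (S : ℝ) * ((N + 1 : ℕ) : ℝ) ^ ((1 : ℝ) / 3)) =
        fun N => Δ N * ((N + 1 : ℕ) : ℝ) ^ ((1 : ℝ) / 3) / (S : ℝ) := by
      funext N; ring
    rw [heq]
    exact hΔg.atTop_div_const hSpos
  filter_upwards [hT (fun N => Δ N / (S : ℝ)) hτ hτg δ hδ (h + 1)] with N hN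
  have hFc : ((Finset.univ.filter fun A : Finset (Fin (N + 1)) => δ * ((N + 1 : ℕ) : ℝ) ≤ (A.card : ℝ)).card
      : ℝ≥0∞) ≤ ((2 ^ (N + 1) : ℕ) : ℝ≥0∞) := by
    exact_mod_cast (Finset.card_filter_le _ _).trans_eq
      (by rw [Finset.card_univ, Fintype.card_finset, Fintype.card_fin])
  set F := Finset.univ.filter fun A : Finset (Fin (N + 1)) => δ * ((N + 1 : ℕ) : ℝ) ≤ (A.card : ℝ) with hF
  calc eqLaw σ θ N (Φ N) {y : Cfg N | δ ≤ idleFr σ N y (Δ N) S r}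
      ≤ ∑ A ∈ F, eqLaw σ θ N (Φ N) (tubeSet σ N A (Δ N / (S : ℝ))) :=
        eqLaw_setOf_le_idleFr_le hσ hσ2 θ N (Φ N) (hΔ N).le S r δ
    _ ≤ ∑ _A ∈ F, ENNReal.ofReal (Real.exp (-((h + 1) * ((N + 1 : ℕ) : ℝ)))) :=
        Finset.sum_le_sum fun A hA => hN (Φ N) A (Finset.mem_filter.1 hA).2
    _ ≤ ((2 ^ (N + 1) : ℕ) : ℝ≥0∞) * ENNReal.ofReal (Real.exp (-((h + 1) * ((N + 1 : ℕ) : ℝ)))) := by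
        rw [Finset.sum_const, nsmul_eq_mul]; gcongr
    _ = ENNReal.ofReal ((2 : ℝ) ^ (N + 1) * Real.exp (-((h + 1) * ((N + 1 : ℕ) : ℝ)))) := by
        rw [ENNReal.ofReal_mul (by positivity), ENNReal.ofReal_pow (by norm_num : (0 : ℝ) ≤ 2),
          ENNReal.ofReal_ofNat]
        push_cast
        rfl
    _ ≤ ENNReal.ofReal (Real.exp (-(h * ((N : ℝ) + 1)))) := ENNReal.ofReal_le_ofReal (two_pow_mul_exp_le h N)

/-- The trivial branch `δ > 1`: the idle event is EMPTY (`idleFr ≤ 1`), for every configuration and law. [folklore] -/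
theorem setOf_le_idleFr_eq_empty {σ : ℝ} {N : ℕ} {Δ : ℝ} {S r : ℕ} {δ : ℝ} (hδ : 1 < δ) :
    {y : Cfg N | δ ≤ idleFr σ N y Δ S r} = ∅ :=
  Set.eq_empty_of_forall_notMem fun y hy => (not_le.2 hδ) (le_trans hy (idleFr_le_one σ N y Δ S r))

/-- The EMPTY-SLOT corner, made explicit: if slot `r` carries no fold step then EVERY particle is idle on it and
`idleFr = 1` — so the idle event contains "slot `r` is empty"; the reduction prices it like any other idle
pattern (all `N+1` straight tubes pairwise separated over the slot). [folklore] -/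
theorem idleFr_eq_one_of_slot_empty {σ : ℝ} {N : ℕ} {y : Cfg N} {Δ : ℝ} {S r : ℕ}
    (h : slotStart σ N y Δ S (r + 1) ≤ slotStart σ N y Δ S r) : idleFr σ N y Δ S r = 1 := by
  unfold idleFr
  have hall : (Finset.univ.filter fun i : Fin (N + 1) => IdleOn σ N y Δ S r i) = Finset.univ := by
    refine Finset.filter_true_of_mem fun i _ => ?_
    intro k hk1 hk2
    exact absurd (lt_of_lt_of_le hk2 h) (not_lt.2 hk1)
  rw [hall, Finset.card_univ, Fintype.card_fin]
  have hN : ((N + 1 : ℕ) : ℝ) ≠ 0 := by positivity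
  exact div_self hN

end FewIdle

/-- **`stub_fewIdleSuperExp` from the static tube large deviation** (registered helper sub-goal of the crux item):
for `0 < σ < 1/2`, `0 < θ`, the tube LD `FewIdle.TubeLD σ θ` implies per-slot idleness is super-exponentially rare
under the invariant law, for every flow family — i.e. exactly the statement of `stub_fewIdleSuperExp` at `(σ, θ)`.
[folklore] -/
theorem fewIdleSuperExp_of_tubeLD : ∀ σ θ : ℝ, 0 < σ → σ < 1 / 2 → 0 < θ → FewIdle.TubeLD σ θ → ∀ Φ : (N : ℕ) → Flow σ N, FewIdleSuperExpAt σ θ Φ :=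
  fun _σ _θ hσ hσ2 _ hT Φ => FewIdle.fewIdleSuperExpAt_of_tubeLD hσ hσ2 hT Φ

end

end Summit.AtomisticToContinuum.HydrodynamicLimit.Theorems.DiffuseBackwardInfluenceShare
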